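import Mathlib
import Summits.QuantumFields.BalabanUV.Beta.FP.CovarianceScalarLetters

/-!
# `BalabanUV.Beta.FP.GaugeFactorRowDiffSocket` — road «FP» (binder row D1), lane IR-5′, **THE GRADIENT LETTER `hAB` OF THE COMPOSITE GAUGE FACTOR
# REDUCED TO TWO FREE MASSIVE LETTERS** (the (T1′) item of `LEAVES-FP.md` row «(T1′) SOCKET … ⟸ ONE DISPLAYED LETTER `hAB`», F5a–F5e):
# `(∂Δ⁻¹R)(RΔ⁻¹∂ᴴ) = ∂·X·∂ᴴ`, `X = G′RG′ = F₁²·W·(1 + G′)·Y` EXACTLY, with `F₁ = (Δ + 1)⁻¹` the FREE massive resolvent and `W`, `Y` row-bounded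
# tree operators — so `(S_ν − 1)·∂X∂ᴴ` is `[(S_ν−1)∂F₁²∂ᴴ]` plus `[(S_ν−1)∂F₁²]·[bounded]`: three resp. two differences on a FOURTH-order free
# resolvent (row sums `≍ 1∕N` by the count `N⁻²·Σ_{|y|≲N}|y|⁻³`, `N⁻³·Σ_{|y|≲N}|y|⁻²`), never two on a second-order one (the `log N` of every
# two-factor split, g22), no Hölder input

HONEST DEPENDENCY (page 1, mandatory): continuum YM on T⁴ ⇐ BetaPertH ∧ nine spine estimates (0/9 proved); BetaPertH ⇐ (D1) ∧ (D4) ∧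
CAP+tail; G-an2-4 gates asym, D1 and NE2/3/4.  HONEST FRAMING (cell contract, verbatim): «discharging `BetaPertH` makes Bałaban's UV
stability UNCONDITIONAL — a real constructive-QFT result; it is NOT the continuum limit and NOT the Clay problem.»  THIS MODULE is finite-dimensional
algebra over the tree's typed torus operators of B5 (`B5Action121.LapS`∕`GradOp`, `B5Block118.QsOp`, `B5Hk160Torus.QsAdj`, `B5LaplaceInverse.LapSinv`,
`B5Identities197Torus.RT`, `B5Prop11Plancherel.shiftM`) composed BY NAME with the lineage's (T0′) chain (`ScalarPropagatorProjection`: `R·Δ⁻¹ = R·G′`,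
(1.44) `R = 1 − G′Q′*(Q′G′²Q′*)⁻¹Q′G′`, `Δ + bQ′*Q′` and `Q′G′²Q′*` invertible; `CovarianceScalarLetters`: `Σ|Q′| = Σ|Q′*| = 1`; `CovarianceRowSum`: row-sum
algebra).  It cites nothing as a hypothesis, mints no `Prop`, has no `def`, 0 sorry; it proves NO estimate: the two FREE letters `φ₂`, `φ₃` (row sums of
`(S−1)·∂·(Δ+1)⁻²` and `(S−1)·∂·(Δ+1)⁻²·∂ᴴ`, translation-invariant Fourier multipliers) and the scalar letters `cG′ cC cD` of the (T0′) chain are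
DISPLAYED.  NOT hAB (= the free letters' file + F5e-style tower assembly), NOT (T1′), NOT hslice, NOT D1, NOT BetaPertH, NOT continuum, NOT Clay.

ABSOLUTE RULE (cell charter, verbatim): «No internally-minted statement may enter as a cited fact. Every hypothesis is either kernel-proved in this
package or a verbatim quotation of a PUBLISHED theorem with page reference. The manuscript(s) under audit are NOT citable for their own disputed
steps — they are the thing under adjudication; programme-internal (2001/route/tribunal) claims are never citable.»

THE MECHANISM (our bookkeeping; `G′ = (Δ + B)⁻¹`, `B = bQ′*Q′`, `F₁(Δ + 1) = 1`, `C = (Q′G′²Q′*)⁻¹`, `Y′ = Q′*CQ′G′`, `Y = 1 − Y′G′`, `W = 1 + (1 − B)G′`).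
(i) resolvent identity `G′ = F₁W` (`(Δ+1)G′ = 1 + (1 − B)G′`); (ii) (1.44) ⟹ `RG′ = G′Y` and `Q′G′R = 0`, hence `BG′R = 0`; so
`X = G′RG′ = F₁W·G′Y = F₁G′Y + F₁(1−B)G′·G′Y = F₁G′Y + F₁G′·RG′ − F₁(BG′R)G′ = F₁²WY + F₁²W(G′Y)` (`F₁G′ = F₁²W`), i.e.
  **`X = F₁²·W·(1 + G′)·Y`**   (`sandwich_eq`) — the free FOURTH-order resolvent in front, bounded operators behind.
Why not the naive `(Δ+1)²`-expansion of `X`: it produces `F₁`-led terms (`(S−1)∂F₁` = two differences on a second-order resolvent, a Calderón–Zygmund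
kernel with `Σ_{|y|≲N}|y|⁻⁴ ≍ log N`); the one such term here, `F₁BG′RG′`, VANISHES IDENTICALLY because the coarse projector annihilates `G′R` (`Q′G′R = 0`).
CONTENT.  §1 abstract algebra (`mul_G_eq`, `eq_free_mul`, **`sandwich_eq`**, `sandwich_expansion`); §2 row sums (`rowSum_add_le`, **`rowSum_sandwich_le`**);
§3 b05's torus: `isUnit_LapS_add_one`, `RT_mul_Gp`, `QsOp_Gp_RT`, `gaugeFactor_eq_sandwich` and the END **`rowSum_shift_gaugeFactor_le`**: for every
`b > 0`, direction `ν` and row `i`,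
  `Σ_j ‖((S_ν − 1)·(∂Δ⁻¹R)(RΔ⁻¹∂ᴴ)) i j‖ ≤ φ₃ + φ₂·(cC·cG′·cD + (2 + b)·g + (1 + b)·cG′·g)`,  `g = cD + cG′·cC·cG′·cD`,
from the FREE letters `φ₃` (`(S_ν−1)·∂·F₁²·∂ᴴ`), `φ₂` (`(S_ν−1)·∂·F₁²`) and the scalar letters `cG′` (`G′`), `cC` (`(Q′G′²Q′*)⁻¹`), `cD` (`G′∂ᴴ`) — all DISPLAYED.
Unit `b2b-balaban-beta-d1-formalise-leaf-05` (gen 23), 2026-08-21; `LEAVES-FP.md` row «(T1′) SOCKET» (plan `HOME/b2b-balaban-beta-d1-formalise-leaf-05/g23/hAB-PLAN.md`).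
«not in print; our bookkeeping» (B5 prints (1.115) for `G` and (1.44) for `R`; the composite, the comparison operator and the proof are ours).
-/

noncomputable section

open scoped BigOperators Matrix ComplexConjugate ComplexOrder

namespace Summit.QuantumFields.BalabanUV.Beta.FP.GaugeFactorRowDiffSocket

open Literature.MathematicalPhysics.QuantumFieldTheory.Balaban1983to89
open Literature.MathematicalPhysics.QuantumFieldTheory.Balaban1983to89.B5Prop11Plancherel (Tor fine shiftM)
open Literature.MathematicalPhysics.QuantumFieldTheory.Balaban1983to89.B5Action121 (GradOp LapS)
open Literature.MathematicalPhysics.QuantumFieldTheory.Balaban1983to89.B5Block118 (QsOp)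
open Literature.MathematicalPhysics.QuantumFieldTheory.Balaban1983to89.B5Hk160Torus (QsAdj)
open Literature.MathematicalPhysics.QuantumFieldTheory.Balaban1983to89.B5LaplaceInverse (LapSinv)
open Literature.MathematicalPhysics.QuantumFieldTheory.Balaban1983to89.B5Identities197Torus (RT RT_mul_RT)
open Summit.QuantumFields.BalabanUV.Beta.FP.CovarianceRowSum (rowSum_mul_le rowSum_sub_le rowSum_nonneg_of_le)
open Summit.QuantumFields.BalabanUV.Beta.FP.ScalarPropagatorProjection (RT_LapSinv_divS_eq grad_LapSinv_RT_eq DeltaP_mul_inv DeltaP_inv_conjTranspose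
  isUnit_QGGQ RT_eq_one_sub_proj144_inv)
open Summit.QuantumFields.BalabanUV.Beta.FP.CovarianceScalarLetters (sum_norm_QsOp_row sum_norm_QsAdj_row)

/-! ## §1 Abstract algebra: `X = G·R·G = F₁²·W·(1 + G)·Y` -/

section Algebra

variable {ι κ : Type*} [Fintype ι] [DecidableEq ι]

/-- [folklore] `(Δ + B)·G = 1` ⟹ `Δ·G = 1 − B·G`. -/
theorem mul_G_eq {Δ B G : Matrix ι ι ℂ} (hG : (Δ + B) * G = 1) : Δ * G = 1 - B * G := by
  rw [eq_sub_iff_add_eq, ← Matrix.add_mul]; exact hG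

/-- [folklore] **THE RESOLVENT IDENTITY**: `F₁·(Δ + 1) = 1`, `(Δ + B)·G = 1` ⟹ `G = F₁·(1 + (1 − B)·G)`. -/
theorem eq_free_mul {Δ B G F₁ : Matrix ι ι ℂ} (hG : (Δ + B) * G = 1) (hF : F₁ * (Δ + 1) = 1) :
    G = F₁ * (1 + (1 - B) * G) := by
  calc G = F₁ * (Δ + 1) * G := by rw [hF, Matrix.one_mul]
    _ = F₁ * ((Δ + 1) * G) := Matrix.mul_assoc _ _ _
    _ = F₁ * (1 + (1 - B) * G) := by
      congr 1
      rw [Matrix.add_mul, mul_G_eq hG, Matrix.sub_mul, Matrix.one_mul]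
      abel

/-- [our bookkeeping] **THE SANDWICH IDENTITY**: under `(Δ + B)·G = 1`, `F₁·(Δ + 1) = 1`, `R·G = G·Y` and `B·G·R = 0`,
`G·R·G = F₁·F₁·(W·Y) + F₁·F₁·(W·(G·Y))` with `W = 1 + (1 − B)·G` — a FOURTH-order free resolvent in front of bounded operators. -/
theorem sandwich_eq {Δ B G F₁ R Y : Matrix ι ι ℂ} (hG : (Δ + B) * G = 1) (hF : F₁ * (Δ + 1) = 1) (hRG : R * G = G * Y)
    (hBGR : B * G * R = 0) :
    G * R * G = F₁ * F₁ * ((1 + (1 - B) * G) * Y) + F₁ * F₁ * ((1 + (1 - B) * G) * (G * Y)) := by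
  set W := 1 + (1 - B) * G with hW
  have e1 : G = F₁ * W := eq_free_mul hG hF
  have e2 : ∀ Z : Matrix ι ι ℂ, G * Z = F₁ * (W * Z) := fun Z => by rw [e1, Matrix.mul_assoc]
  have e3 : B * (G * (G * Y)) = 0 := by
    rw [← hRG, ← Matrix.mul_assoc, ← Matrix.mul_assoc, hBGR, Matrix.zero_mul]
  calc G * R * G = G * (G * Y) := by rw [Matrix.mul_assoc, hRG]
    _ = F₁ * (W * (G * Y)) := e2 _
    _ = F₁ * (G * Y) + F₁ * (G * (G * Y)) - F₁ * (B * (G * (G * Y))) := by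
      rw [hW]
      simp only [Matrix.add_mul, Matrix.sub_mul, Matrix.one_mul, Matrix.mul_add, Matrix.mul_sub, Matrix.mul_assoc]
      abel
    _ = F₁ * (F₁ * (W * Y)) + F₁ * (F₁ * (W * (G * Y))) := by
      rw [e3, Matrix.mul_zero, sub_zero, e2 (G * Y)]
      congr 1
      rw [e2 Y]
    _ = F₁ * F₁ * (W * Y) + F₁ * F₁ * (W * (G * Y)) := by rw [Matrix.mul_assoc, Matrix.mul_assoc]

/-- [our bookkeeping] **THE SANDWICHED EXPANSION** with `Y = 1 − Y′·G` written out: left-multiplying by `D` (`= (S−1)∂`) and right-multiplying by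
`E` (`= ∂ᴴ`), `D·(G·R·G)·E` is `D·F₁²·E` plus four terms `D·F₁²·(bounded)`. -/
theorem sandwich_expansion {Δ B G F₁ R Y' : Matrix ι ι ℂ} {D : Matrix κ ι ℂ} {E : Matrix ι κ ℂ}
    (hG : (Δ + B) * G = 1) (hF : F₁ * (Δ + 1) = 1) (hRG : R * G = G * (1 - Y' * G)) (hBGR : B * G * R = 0) :
    D * (G * R * G) * E
      = D * (F₁ * F₁) * E - D * (F₁ * F₁) * (Y' * (G * E)) + D * (F₁ * F₁) * ((1 - B) * (G * E - G * (Y' * (G * E))))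
        + D * (F₁ * F₁) * (G * E - G * (Y' * (G * E))) + D * (F₁ * F₁) * ((1 - B) * (G * (G * E - G * (Y' * (G * E))))) := by
  rw [sandwich_eq hG hF hRG hBGR]
  simp only [Matrix.mul_add, Matrix.mul_sub, Matrix.add_mul, Matrix.sub_mul, Matrix.mul_one, Matrix.one_mul, Matrix.mul_assoc]
  abel

end Algebra

/-! ## §2 Row sums of the sandwiched expansion -/

section RowSum

variable {ι κ : Type*} [Fintype ι]

/-- [folklore] row-sum letters add. -/
theorem rowSum_add_le {A B : Matrix κ ι ℂ} {a b : ℝ} (hA : ∀ i, ∑ j, ‖A i j‖ ≤ a) (hB : ∀ i, ∑ j, ‖B i j‖ ≤ b) (i : κ) :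
    ∑ j, ‖(A + B) i j‖ ≤ a + b := by
  calc ∑ j, ‖(A + B) i j‖ ≤ ∑ j, (‖A i j‖ + ‖B i j‖) := Finset.sum_le_sum fun j _ => by
        rw [Matrix.add_apply]; exact norm_add_le _ _
    _ = ∑ j, ‖A i j‖ + ∑ j, ‖B i j‖ := Finset.sum_add_distrib
    _ ≤ a + b := add_le_add (hA i) (hB i)

variable [DecidableEq ι] [Fintype κ]

/-- [our bookkeeping] **ROW SUMS OF THE SANDWICH `D·(G·R·G)·E`** from the two FREE letters (`φ₃` for `D·F₁²·E`, `φ₂` for `D·F₁²`) and the structural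
letters `β` (`B`), `cG` (`G`), `cD` (`G·E`), `cY` (`Y′`): `≤ φ₃ + φ₂·(cY·cD + (2 + β)·g + (1 + β)·cG·g)` with `g = cD + cG·cY·cD`. -/
theorem rowSum_sandwich_le [Nonempty ι] {Δ B G F₁ R Y' : Matrix ι ι ℂ} {D : Matrix κ ι ℂ} {E : Matrix ι κ ℂ}
    (hG : (Δ + B) * G = 1) (hF : F₁ * (Δ + 1) = 1) (hRG : R * G = G * (1 - Y' * G)) (hBGR : B * G * R = 0)
    {φ₂ φ₃ β cG cD cY : ℝ}
    (hφ3 : ∀ i, ∑ j, ‖(D * (F₁ * F₁) * E) i j‖ ≤ φ₃) (hφ2 : ∀ i, ∑ x, ‖(D * (F₁ * F₁)) i x‖ ≤ φ₂)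
    (hB : ∀ x, ∑ x', ‖B x x'‖ ≤ β) (hGr : ∀ x, ∑ x', ‖G x x'‖ ≤ cG) (hD : ∀ x, ∑ j, ‖(G * E) x j‖ ≤ cD)
    (hY : ∀ x, ∑ x', ‖Y' x x'‖ ≤ cY) (i : κ) :
    ∑ j, ‖(D * (G * R * G) * E) i j‖
      ≤ φ₃ + φ₂ * (cY * cD + (2 + β) * (cD + cG * (cY * cD)) + (1 + β) * (cG * (cD + cG * (cY * cD)))) := by
  rw [sandwich_expansion hG hF hRG hBGR]
  -- the structural factors
  have hone : ∀ x, ∑ x', ‖(1 : Matrix ι ι ℂ) x x'‖ ≤ 1 := fun x => (CovarianceScalarLetters.rowSum_one x).le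
  have h1B : ∀ x, ∑ x', ‖((1 - B) : Matrix ι ι ℂ) x x'‖ ≤ 1 + β := rowSum_sub_le hone hB
  have hYGE : ∀ x, ∑ j, ‖(Y' * (G * E)) x j‖ ≤ cY * cD := rowSum_mul_le hY hD
  have hGYGE : ∀ x, ∑ j, ‖(G * (Y' * (G * E))) x j‖ ≤ cG * (cY * cD) := rowSum_mul_le hGr hYGE
  have hg : ∀ x, ∑ j, ‖(G * E - G * (Y' * (G * E))) x j‖ ≤ cD + cG * (cY * cD) := rowSum_sub_le hD hGYGE
  have hGg : ∀ x, ∑ j, ‖(G * (G * E - G * (Y' * (G * E)))) x j‖ ≤ cG * (cD + cG * (cY * cD)) := rowSum_mul_le hGr hg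
  have h1Bg := rowSum_mul_le h1B hg
  have h1BGg := rowSum_mul_le h1B hGg
  -- the five terms
  have t2 := rowSum_mul_le hφ2 hYGE
  have t3 := rowSum_mul_le hφ2 h1Bg
  have t4 := rowSum_mul_le hφ2 hg
  have t5 := rowSum_mul_le hφ2 h1BGg
  have s1 := rowSum_sub_le hφ3 t2
  have s2 := rowSum_add_le s1 t3
  have s3 := rowSum_add_le s2 t4
  have s4 := rowSum_add_le s3 t5 i
  nlinarith [s4]

end RowSum

/-! ## §3 b05's torus: `(∂Δ⁻¹R)(RΔ⁻¹∂ᴴ) = ∂·G′RG′·∂ᴴ`, `RG′ = G′Y`, `Q′G′R = 0`, and the END with displayed letters -/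

section Torus

variable {d : ℕ} (n : ℕ) [NeZero n] (M : Fin d → ℕ) [hM : ∀ μ, NeZero (M μ)]

/-- [folklore] `Δ + 1` is invertible on the torus (`Δ = Σ_ν ∂_νᴴ∂_ν` is positive semidefinite). -/
theorem isUnit_LapS_add_one : IsUnit (LapS (fine n M) (n : ℂ) + 1) := by
  have hps : (LapS (fine n M) (n : ℂ)).PosSemidef := by
    unfold LapS
    exact Matrix.posSemidef_sum Finset.univ fun ν _ => Matrix.posSemidef_conjTranspose_mul_self _
  exact (Matrix.PosDef.posSemidef_add hps Matrix.PosDef.one).isUnit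

/-- [folklore] `F₁ := (Δ+1)⁻¹` satisfies `F₁·(Δ + 1) = 1`. -/
theorem freeResolvent_mul : (LapS (fine n M) (n : ℂ) + 1)⁻¹ * (LapS (fine n M) (n : ℂ) + 1) = 1 :=
  Matrix.nonsing_inv_mul _ ((Matrix.isUnit_iff_isUnit_det _).mp (isUnit_LapS_add_one n M))

variable {b : ℝ} (hb : 0 < b)
include hb

/-- [folklore] `(Q′G′²Q′*)·(Q′G′²Q′*)⁻¹ = 1`. -/
theorem QGGQ_mul_inv :
    (QsOp n M * (LapS (fine n M) (n : ℂ) + (b : ℂ) • (QsAdj n M * QsOp n M))⁻¹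
        * (LapS (fine n M) (n : ℂ) + (b : ℂ) • (QsAdj n M * QsOp n M))⁻¹ * QsAdj n M)
      * (QsOp n M * (LapS (fine n M) (n : ℂ) + (b : ℂ) • (QsAdj n M * QsOp n M))⁻¹
        * (LapS (fine n M) (n : ℂ) + (b : ℂ) • (QsAdj n M * QsOp n M))⁻¹ * QsAdj n M)⁻¹ = 1 :=
  Matrix.mul_nonsing_inv _ ((Matrix.isUnit_iff_isUnit_det _).mp (isUnit_QGGQ n M hb))

/-- [our bookkeeping] **(1.44) AS A COMMUTATION**: `R·G′ = G′·(1 − Y′·G′)` with `Y′ = Q′*·(Q′G′²Q′*)⁻¹·Q′·G′`. -/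
theorem RT_mul_Gp :
    RT n M * (LapS (fine n M) (n : ℂ) + (b : ℂ) • (QsAdj n M * QsOp n M))⁻¹
      = (LapS (fine n M) (n : ℂ) + (b : ℂ) • (QsAdj n M * QsOp n M))⁻¹
        * (1 - (QsAdj n M * (QsOp n M * (LapS (fine n M) (n : ℂ) + (b : ℂ) • (QsAdj n M * QsOp n M))⁻¹
              * (LapS (fine n M) (n : ℂ) + (b : ℂ) • (QsAdj n M * QsOp n M))⁻¹ * QsAdj n M)⁻¹
            * QsOp n M * (LapS (fine n M) (n : ℂ) + (b : ℂ) • (QsAdj n M * QsOp n M))⁻¹)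
          * (LapS (fine n M) (n : ℂ) + (b : ℂ) • (QsAdj n M * QsOp n M))⁻¹) := by
  rw [RT_eq_one_sub_proj144_inv n M hb]
  simp only [Matrix.sub_mul, Matrix.one_mul, Matrix.mul_sub, Matrix.mul_one, Matrix.mul_assoc]

/-- [our bookkeeping] **THE COARSE PROJECTOR ANNIHILATES `G′R`**: `Q′·G′·R = 0` ((1.44) and `(Q′G′²Q′*)·(Q′G′²Q′*)⁻¹ = 1`). -/
theorem QsOp_Gp_RT : QsOp n M * (LapS (fine n M) (n : ℂ) + (b : ℂ) • (QsAdj n M * QsOp n M))⁻¹ * RT n M = 0 := by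
  set Gi := (LapS (fine n M) (n : ℂ) + (b : ℂ) • (QsAdj n M * QsOp n M))⁻¹ with hGi
  have h := QGGQ_mul_inv n M hb
  set Ci := (QsOp n M * Gi * Gi * QsAdj n M)⁻¹ with hCi
  rw [RT_eq_one_sub_proj144_inv n M hb, Matrix.mul_sub, Matrix.mul_one, sub_eq_zero]
  symm
  calc QsOp n M * Gi * (Gi * QsAdj n M * Ci * QsOp n M * Gi)
      = (QsOp n M * Gi * Gi * QsAdj n M * Ci) * (QsOp n M * Gi) := by simp only [Matrix.mul_assoc]
    _ = QsOp n M * Gi := by rw [h, Matrix.one_mul]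

/-- [our bookkeeping] `B·G′·R = 0` for `B = bQ′*Q′`. -/
theorem Bq_Gp_RT : (b : ℂ) • (QsAdj n M * QsOp n M) * (LapS (fine n M) (n : ℂ) + (b : ℂ) • (QsAdj n M * QsOp n M))⁻¹ * RT n M = 0 := by
  rw [Matrix.smul_mul, Matrix.smul_mul, Matrix.mul_assoc (QsAdj n M), Matrix.mul_assoc (QsAdj n M), QsOp_Gp_RT n M hb,
    Matrix.mul_zero, smul_zero]

/-- [our bookkeeping] **THE COMPOSITE GAUGE FACTOR IS A `G′RG′`-SANDWICH**: `(∂·Δ⁻¹·R)·(R·Δ⁻¹·∂ᴴ) = ∂·(G′·R·G′)·∂ᴴ` with `G′ = (Δ + bQ′*Q′)⁻¹`, every `b > 0`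
(`ScalarPropagatorProjection.grad_LapSinv_RT_eq` ∕ `RT_LapSinv_divS_eq`, `R² = R`). -/
theorem gaugeFactor_eq_sandwich :
    (GradOp (fine n M) (n : ℂ) * LapSinv (fine n M) (n : ℂ) * RT n M) * (RT n M * LapSinv (fine n M) (n : ℂ) * (GradOp (fine n M) (n : ℂ))ᴴ)
      = GradOp (fine n M) (n : ℂ)
          * ((LapS (fine n M) (n : ℂ) + (b : ℂ) • (QsAdj n M * QsOp n M))⁻¹ * RT n M * (LapS (fine n M) (n : ℂ) + (b : ℂ) • (QsAdj n M * QsOp n M))⁻¹)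
          * (GradOp (fine n M) (n : ℂ))ᴴ := by
  rw [grad_LapSinv_RT_eq n M b (DeltaP_mul_inv n M hb) (DeltaP_inv_conjTranspose n M), RT_LapSinv_divS_eq n M b (DeltaP_mul_inv n M hb)]
  simp only [Matrix.mul_assoc]
  rw [← Matrix.mul_assoc (RT n M) (RT n M), RT_mul_RT]

/-- [our bookkeeping] **THE END — `hAB`'s ROW SUM FROM TWO FREE LETTERS AND THREE SCALAR LETTERS**: for `b > 0`, a direction `ν` and a row `i`, with
`F₁ = (Δ + 1)⁻¹`, `G′ = (Δ + bQ′*Q′)⁻¹`, `g = cD + cG′·(cC·cG′·cD)`: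
`Σ_j ‖((S_ν − 1)·(∂Δ⁻¹R)(RΔ⁻¹∂ᴴ)) i j‖ ≤ φ₃ + φ₂·(cC·cG′·cD + (2 + b)·g + (1 + b)·cG′·g)`,
from the FREE letters `φ₃` (row sums of `(S_ν−1)·∂·F₁²·∂ᴴ`), `φ₂` (of `(S_ν−1)·∂·F₁²`) and the scalar letters `cG′` (`G′`), `cC` (`(Q′G′²Q′*)⁻¹`), `cD` (`G′·∂ᴴ`) of
`CovarianceScalarLetters` — all DISPLAYED.  On the tower tori `φ₂, φ₃ ≍ 1∕N` (the free letters' file) give `hAB` with the EXACT power. -/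
theorem rowSum_shift_gaugeFactor_le (ν : Fin d) {φ₂ φ₃ cG' cC cD : ℝ}
    (hφ3 : ∀ i, ∑ j, ‖((shiftM (fine n M) ν - 1) * GradOp (fine n M) (n : ℂ)
      * ((LapS (fine n M) (n : ℂ) + 1)⁻¹ * (LapS (fine n M) (n : ℂ) + 1)⁻¹) * (GradOp (fine n M) (n : ℂ))ᴴ
        : Matrix (Tor (fine n M) × Fin d) (Tor (fine n M) × Fin d) ℂ) i j‖ ≤ φ₃)
    (hφ2 : ∀ i, ∑ x, ‖((shiftM (fine n M) ν - 1) * GradOp (fine n M) (n : ℂ)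
      * ((LapS (fine n M) (n : ℂ) + 1)⁻¹ * (LapS (fine n M) (n : ℂ) + 1)⁻¹)
        : Matrix (Tor (fine n M) × Fin d) (Tor (fine n M)) ℂ) i x‖ ≤ φ₂)
    (hG' : ∀ x, ∑ x', ‖(LapS (fine n M) (n : ℂ) + (b : ℂ) • (QsAdj n M * QsOp n M))⁻¹ x x'‖ ≤ cG')
    (hC : ∀ y, ∑ y', ‖(QsOp n M * (LapS (fine n M) (n : ℂ) + (b : ℂ) • (QsAdj n M * QsOp n M))⁻¹
      * (LapS (fine n M) (n : ℂ) + (b : ℂ) • (QsAdj n M * QsOp n M))⁻¹ * QsAdj n M)⁻¹ y y'‖ ≤ cC)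
    (hD : ∀ x, ∑ j, ‖((LapS (fine n M) (n : ℂ) + (b : ℂ) • (QsAdj n M * QsOp n M))⁻¹ * (GradOp (fine n M) (n : ℂ))ᴴ) x j‖ ≤ cD)
    (i : Tor (fine n M) × Fin d) :
    ∑ j, ‖((shiftM (fine n M) ν - 1) *
      ((GradOp (fine n M) (n : ℂ) * LapSinv (fine n M) (n : ℂ) * RT n M) * (RT n M * LapSinv (fine n M) (n : ℂ) * (GradOp (fine n M) (n : ℂ))ᴴ))
        : Matrix (Tor (fine n M) × Fin d) (Tor (fine n M) × Fin d) ℂ) i j‖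
      ≤ φ₃ + φ₂ * (cC * cG' * cD + (2 + b) * (cD + cG' * (cC * cG' * cD)) + (1 + b) * (cG' * (cD + cG' * (cC * cG' * cD)))) := by
  haveI : Nonempty (Tor (fine n M)) := ⟨i.1⟩
  set Δ := LapS (fine n M) (n : ℂ) with hΔ
  set Bm := (b : ℂ) • (QsAdj n M * QsOp n M) with hBm
  set G := (Δ + Bm)⁻¹ with hGdef
  set F₁ := (Δ + 1)⁻¹ with hF₁
  set Ci := (QsOp n M * G * G * QsAdj n M)⁻¹ with hCi
  set Y' := QsAdj n M * Ci * QsOp n M * G with hY'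
  set Dm := (shiftM (fine n M) ν - 1) * GradOp (fine n M) (n : ℂ) with hDm
  set E := (GradOp (fine n M) (n : ℂ))ᴴ with hE
  have hGinv : (Δ + Bm) * G = 1 := DeltaP_mul_inv n M hb
  have hF : F₁ * (Δ + 1) = 1 := freeResolvent_mul n M
  have hRG : RT n M * G = G * (1 - Y' * G) := by rw [hY', RT_mul_Gp n M hb]
  have hBGR : Bm * G * RT n M = 0 := Bq_Gp_RT n M hb
  -- the structural letters
  have hBrow : ∀ x, ∑ x', ‖Bm x x'‖ ≤ b := by
    intro x
    have h := rowSum_mul_le (fun x => (sum_norm_QsAdj_row n M x).le) (fun y => (sum_norm_QsOp_row n M y).le) x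
    calc ∑ x', ‖Bm x x'‖ = ∑ x', ‖(b : ℂ)‖ * ‖(QsAdj n M * QsOp n M) x x'‖ := by
          simp only [hBm, Matrix.smul_apply, smul_eq_mul, norm_mul]
      _ = ‖(b : ℂ)‖ * ∑ x', ‖(QsAdj n M * QsOp n M) x x'‖ := (Finset.mul_sum _ _ _).symm
      _ ≤ b * (1 * 1) := by
          rw [Complex.norm_real, Real.norm_eq_abs, abs_of_pos hb]
          exact mul_le_mul_of_nonneg_left h hb.le
      _ = b := by ring
  have hYrow : ∀ x, ∑ x', ‖Y' x x'‖ ≤ cC * cG' := by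
    intro x
    have h1 : ∀ x, ∑ y, ‖(QsAdj n M * Ci) x y‖ ≤ 1 * cC := rowSum_mul_le (fun x => (sum_norm_QsAdj_row n M x).le) hC
    have h2 : ∀ x, ∑ x', ‖(QsAdj n M * Ci * QsOp n M) x x'‖ ≤ 1 * cC * 1 := rowSum_mul_le h1 (fun y => (sum_norm_QsOp_row n M y).le)
    have h3 := rowSum_mul_le h2 hG' x
    calc ∑ x', ‖Y' x x'‖ = ∑ x', ‖(QsAdj n M * Ci * QsOp n M * G) x x'‖ := by rw [hY']
      _ ≤ 1 * cC * 1 * cG' := h3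
      _ = cC * cG' := by ring
  -- rewrite the gauge factor as the sandwich and apply §2
  have hsand : (shiftM (fine n M) ν - 1) *
      ((GradOp (fine n M) (n : ℂ) * LapSinv (fine n M) (n : ℂ) * RT n M) * (RT n M * LapSinv (fine n M) (n : ℂ) * (GradOp (fine n M) (n : ℂ))ᴴ))
        = Dm * (G * RT n M * G) * E := by
    rw [gaugeFactor_eq_sandwich n M hb]
    simp only [hDm, hE, hGdef, hΔ, hBm, Matrix.mul_assoc]
  rw [hsand]
  have h := rowSum_sandwich_le hGinv hF hRG hBGR hφ3 hφ2 hBrow hG' hD hYrow i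
  have e : cC * cG' * cD = (cC * cG') * cD := by ring
  rw [e]
  exact h

end Torus

end Summit.QuantumFields.BalabanUV.Beta.FP.GaugeFactorRowDiffSocket

end
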